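import Summits.ABC.StewartYu.EuclideanNearestPlane
import Literature.NumberTheory.DiophantineGeometry.MultiplicativeGroupApproximationProp434Proofs
import HarnessLib

/-!
# A Mahler basis for the Euclidean norm: `‖y_j‖² ≤ (j+1) · ‖v_j‖²`

Cell topic `Summits/ABC/StewartYu` (cell abc-stewartyu, seat p1); namespace
`Summit.ABC.StewartYu.PrincipalLattice` (theorems only, no definition, no named fact). Part of the
sharpening WP-M♭ of the reduction of `p`-adic linear forms in logarithms of primes to Kummer-free
principal generators (`PadicLogFormsPrincipalReductionSharp.lean`): the loss `(m!)²` of WP-M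
(Minkowski `m!` × Mahler `m!`) drops to `m^m √(m!)` when Mahler's basis construction is run in a
EUCLIDEAN norm with a nearest-plane reduction (`EuclideanNearestPlane.lean`) instead of rounding.

* `exists_int_basis_sq_le_of_directional` — **Mahler's basis theorem, Euclidean form**: for a linear
  map `Φ : ℝ^q → E` into a real inner product space and a directional system `v₀, …, v_{q−1} ∈ ℤ^q`
  (linearly independent, `‖Φ v₀‖ ≤ ⋯ ≤ ‖Φ v_{q−1}‖`) there is a `ℤ`-basis `y₀, …, y_{q−1}` of `ℤ^q`
  with `‖Φ y_j‖² ≤ (j+1) · ‖Φ v_j‖²` (indeed `≤ ‖Φ v_j‖² + ¼ ∑_{i<j} ‖Φ v_i‖²`), against the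
  `(j+1) · N(v_j)` of the general-norm version `Dioph.exists_int_basis_le_of_directional`
  [cite: EvertseGyory2015, Thm 4.3.3 (p. 70)] proved in the tree, whose construction and proof this
  file follows verbatim, replacing only the final reduction step;
* `exists_int_basis_prod_le_sqrt_factorial` — product form `∏ ‖Φ y_j‖ ≤ √(q!) · ∏ ‖Φ v_j‖`.

## References

* [EvertseGyory2015] J.-H. Evertse, K. Győry, *Unit Equations in Diophantine Number Theory*,
  CUP 2015 — Thm 4.3.3 (p. 70) (Mahler's basis theorem).
-/

noncomputable section

open Finset Module Set
open scoped RealInnerProductSpace Matrix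

namespace Summit.ABC.StewartYu.PrincipalLattice

variable {E : Type*} [NormedAddCommGroup E] [InnerProductSpace ℝ E] [FiniteDimensional ℝ E]

/-! ### Mahler's basis theorem for the Euclidean norm -/

variable {q : ℕ}

/-- **Mahler's basis theorem, Euclidean form** (cf. Evertse–Győry, Thm 4.3.3, and
`Dioph.exists_int_basis_le_of_directional`). Let `Φ : ℝ^q → E` be linear into a real inner product
space and `v₀, …, v_{q−1} ∈ ℤ^q` linearly independent over `ℝ` with
`‖Φ v₀‖ ≤ ⋯ ≤ ‖Φ v_{q−1}‖`. Then `ℤ^q` has a `ℤ`-basis `y₀, …, y_{q−1}` (a generating system of `q`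
non-zero vectors) with `‖Φ y_j‖² ≤ (j+1) · ‖Φ v_j‖²`. Construction as in the tree's general-norm
version (`y_j` = a vector of `ℤ^q ∩ span_ℝ(v₀,…,v_j)` with least positive `v_j`-coordinate
`m_j ∈ (0,1]`), but reduced modulo `ℤv₀ + ⋯ + ℤv_{j−1}` by the nearest-plane bound
`exists_int_comb_norm_sub_sq_le` applied to the projection of `Φ y_j` onto
`K = span(Φ v₀, …, Φ v_{j−1})`: then `Φ y_j = a + m_j (Φ v_j − P_K Φ v_j)` with `a ∈ K`,
`‖a‖² ≤ ¼ ∑_{i<j} ‖Φ v_i‖²`, so `‖Φ y_j‖² ≤ ¼ ∑_{i<j} ‖Φ v_i‖² + ‖Φ v_j‖² ≤ (j+1) ‖Φ v_j‖²`.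
[cite: EvertseGyory2015, Thm 4.3.3 (p. 70)] -/
theorem exists_int_basis_sq_le_of_directional (Φ : (Fin q → ℝ) →ₗ[ℝ] E)
    (v : Fin q → Fin q → ℤ) (hli : LinearIndependent ℝ (fun k i => (v k i : ℝ)))
    (hmono : Monotone (fun k => ‖Φ (fun i => (v k i : ℝ))‖)) :
    ∃ y : Fin q → Fin q → ℤ, Submodule.span ℤ (Set.range y) = ⊤ ∧ (∀ j, y j ≠ 0) ∧
      ∀ j : Fin q, ‖Φ (fun i => (y j i : ℝ))‖ ^ 2 ≤
        ((j : ℕ) + 1) * ‖Φ (fun i => (v j i : ℝ))‖ ^ 2 := by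
  classical
  -- the degenerate case `q = 0`
  rcases Nat.eq_zero_or_pos q with hq | hq
  · subst hq
    refine ⟨v, ?_, fun j => Fin.elim0 j, fun j => Fin.elim0 j⟩
    refine Submodule.eq_top_iff'.mpr fun w => ?_
    have : w = 0 := Subsingleton.elim _ _
    rw [this]; exact Submodule.zero_mem _
  haveI : Nonempty (Fin q) := ⟨⟨0, hq⟩⟩
  -- notation
  set V : Fin q → Fin q → ℝ := fun k i => (v k i : ℝ) with hV
  let cast : (Fin q → ℤ) → (Fin q → ℝ) := fun z i => (z i : ℝ)
  have cast_sub : ∀ w w' : Fin q → ℤ, cast (w - w') = cast w - cast w' := by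
    intro w w'; ext i; simp [cast]
  have cast_zsmul : ∀ (t : ℤ) (w : Fin q → ℤ), cast (t • w) = (t : ℝ) • cast w := by
    intro t w; ext i; simp [cast]
  have cast_v : ∀ k, cast (v k) = V k := fun k => rfl
  have cast_inj : ∀ w w' : Fin q → ℤ, cast w = cast w' → w = w' := by
    intro w w' h; ext i
    have := congrFun h i
    simp only [cast] at this
    exact_mod_cast this
  -- the basis `V` of `ℝ^q` and its coordinate functionals
  have hcard : Fintype.card (Fin q) = finrank ℝ (Fin q → ℝ) := by simp
  let bV : Basis (Fin q) ℝ (Fin q → ℝ) := basisOfLinearIndependentOfCardEqFinrank hli hcard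
  have bV_apply : ∀ k, bV k = V k := fun k => by
    show basisOfLinearIndependentOfCardEqFinrank hli hcard k = V k
    rw [coe_basisOfLinearIndependentOfCardEqFinrank]
  let c : (Fin q → ℝ) → Fin q → ℝ := fun w => bV.repr w
  have c_add : ∀ w w', c (w + w') = c w + c w' := by
    intro w w'; ext i; simp [c]
  have c_sub : ∀ w w', c (w - w') = c w - c w' := by
    intro w w'; ext i; simp [c]
  have c_smul : ∀ (t : ℝ) w, c (t • w) = t • c w := by
    intro t w; ext i; simp [c]
  have c_V : ∀ k, c (V k) = Pi.single k 1 := by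
    intro k
    ext i
    rw [← bV_apply]
    simp [c, Finsupp.single_apply, Pi.single_apply, eq_comm]
  have c_sum : ∀ w, ∑ i, c w i • V i = w := by
    intro w
    have := bV.sum_repr w
    simpa [c, bV_apply] using this
  have c_eq_zero : ∀ w, (∀ i, c w i = 0) → w = 0 := by
    intro w h
    rw [← c_sum w]
    exact Finset.sum_eq_zero fun i _ => by simp [h i]
  -- integrality: `c (cast z) i * D ∈ ℤ` for `D = |det(v)|`
  set Mz : Matrix (Fin q) (Fin q) ℤ := Matrix.of fun i k => v k i with hMz
  set M : Matrix (Fin q) (Fin q) ℝ := Matrix.of fun i k => V k i with hM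
  have hMmap : (Int.castRingHom ℝ).mapMatrix Mz = M := by
    ext i k; simp [hMz, hM, hV]
  have hcolM : M.col = V := by ext k i; simp [hM, Matrix.col]
  have hMunit : IsUnit M := Matrix.linearIndependent_cols_iff_isUnit.mp (hcolM ▸ hli)
  have hdetM : M.det ≠ 0 := ((Matrix.isUnit_iff_isUnit_det _).mp hMunit).ne_zero
  have hdetMz : Mz.det ≠ 0 := by
    intro h
    apply hdetM
    rw [← hMmap, ← RingHom.map_det, h, map_zero]
  have hdetcast : ((Mz.det : ℤ) : ℝ) = M.det := by
    rw [← hMmap, ← RingHom.map_det]; rfl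
  have hmulVec : ∀ w, M *ᵥ (c w) = w := by
    intro w
    conv_rhs => rw [← c_sum w]
    ext i
    simp [hM, Matrix.mulVec, dotProduct, Finset.sum_apply, mul_comm]
  have hcramer : ∀ w i, c w i * M.det = (M.updateCol i w).det := by
    intro w i
    have h1 : M.cramer w = M.det • c w := by
      conv_lhs => rw [← hmulVec w]
      rw [Matrix.cramer_eq_adjugate_mulVec, Matrix.mulVec_mulVec, Matrix.adjugate_mul,
        Matrix.smul_mulVec, Matrix.one_mulVec]
    have := congrFun h1 i
    rw [Matrix.cramer_apply, Pi.smul_apply, smul_eq_mul] at this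
    rw [this, mul_comm]
  set D : ℕ := Mz.det.natAbs with hD
  have hDpos : 0 < D := Int.natAbs_pos.mpr hdetMz
  have hint : ∀ (z : Fin q → ℤ) (i : Fin q), ∃ n : ℤ, c (cast z) i * D = n := by
    intro z i
    have h1 : c (cast z) i * M.det = ((Mz.updateCol i z).det : ℝ) := by
      rw [hcramer]
      have : M.updateCol i (cast z) = (Int.castRingHom ℝ).mapMatrix (Mz.updateCol i z) := by
        ext i' k
        simp only [Matrix.updateCol_apply, hM, hMz, RingHom.mapMatrix_apply, Matrix.map_apply,
          Matrix.of_apply, cast, hV]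
        split_ifs <;> simp
      rw [this, ← RingHom.map_det]; rfl
    have hDreal : (D : ℝ) = |(Mz.det : ℝ)| := by
      rw [hD, Nat.cast_natAbs, Int.cast_abs]
    rcases le_or_gt 0 Mz.det with hpos | hneg
    · refine ⟨(Mz.updateCol i z).det, ?_⟩
      rw [hDreal, abs_of_nonneg (by exact_mod_cast hpos), hdetcast, h1]
    · refine ⟨-(Mz.updateCol i z).det, ?_⟩
      rw [hDreal, abs_of_neg (by exact_mod_cast hneg), hdetcast, mul_neg, h1, Int.cast_neg]
  -- for each `j`: a vector of `ℤ^q ∩ span(v₀..v_j)` with least positive `v_j`-coordinate,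
  -- reduced modulo `ℤv₀ + ⋯ + ℤv_{j-1}` by the nearest-plane bound in `E`
  have key : ∀ j : Fin q, ∃ (yj : Fin q → ℤ) (m : ℝ), 0 < m ∧ m ≤ 1 ∧
      (∀ i, j < i → c (cast yj) i = 0) ∧ c (cast yj) j = m ∧
      (‖Φ (cast yj)‖ ^ 2 ≤ ((j : ℕ) + 1) * ‖Φ (V j)‖ ^ 2) ∧
      (∀ w : Fin q → ℤ, (∀ i, j < i → c (cast w) i = 0) → ∃ t : ℤ, c (cast w) j = t * m) := by
    intro j
    let S : ℕ → Prop := fun n => 0 < n ∧ ∃ w : Fin q → ℤ, (∀ i, j < i → c (cast w) i = 0) ∧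
      c (cast w) j * D = n
    have hSD : S D := by
      refine ⟨hDpos, v j, fun i hi => ?_, ?_⟩
      · rw [cast_v, c_V]; simp [(ne_of_gt hi)]
      · rw [cast_v, c_V]; simp
    have hS : ∃ n, S n := ⟨D, hSD⟩
    set n₀ := Nat.find hS with hn₀
    obtain ⟨hn₀pos, w₀, hw₀Λ, hw₀⟩ : S n₀ := Nat.find_spec hS
    have hn₀D : n₀ ≤ D := Nat.find_min' hS hSD
    set m : ℝ := (n₀ : ℝ) / D with hm
    have hDr : (0 : ℝ) < D := by exact_mod_cast hDpos
    have hm0 : 0 < m := div_pos (by exact_mod_cast hn₀pos) hDr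
    have hm1 : m ≤ 1 := (div_le_one hDr).mpr (by exact_mod_cast hn₀D)
    have hcw₀ : c (cast w₀) j = m := by
      rw [hm, eq_div_iff hDr.ne']; exact hw₀
    -- divisibility of top coordinates by `m`
    have hdiv : ∀ w : Fin q → ℤ, (∀ i, j < i → c (cast w) i = 0) →
        ∃ t : ℤ, c (cast w) j = t * m := by
      intro w hw
      obtain ⟨a, ha⟩ := hint w j
      set t : ℤ := a / n₀ with ht
      refine ⟨t, ?_⟩
      -- the remainder vector
      set r : ℤ := a % n₀ with hr
      have hr0 : 0 ≤ r := Int.emod_nonneg _ (by exact_mod_cast hn₀pos.ne')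
      have hrlt : r < n₀ := Int.emod_lt_of_pos _ (by exact_mod_cast hn₀pos)
      have hdecomp : a = n₀ * t + r := by
        rw [hr, ht]; have := Int.emod_add_mul_ediv a n₀; linarith
      set w' : Fin q → ℤ := w - t • w₀ with hw'
      have hcw' : ∀ i, c (cast w') i = c (cast w) i - (t : ℝ) * c (cast w₀) i := by
        intro i
        rw [hw', cast_sub, cast_zsmul, c_sub, c_smul]
        simp
      have hw'Λ : ∀ i, j < i → c (cast w') i = 0 := by
        intro i hi; rw [hcw' i, hw i hi, hw₀Λ i hi]; ring
      have hw'j : c (cast w') j * D = r := by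
        rw [hcw' j, sub_mul, ha, mul_assoc, hw₀, hdecomp]
        push_cast; ring
      have hr_zero : r = 0 := by
        by_contra hrne
        have hrpos : 0 < r := lt_of_le_of_ne hr0 (Ne.symm hrne)
        have hSr : S r.toNat := by
          refine ⟨by omega, w', hw'Λ, ?_⟩
          rw [hw'j]
          have : ((r.toNat : ℕ) : ℤ) = r := Int.toNat_of_nonneg hr0
          exact_mod_cast this.symm
        have hmin := Nat.find_min' hS hSr
        rw [← hn₀] at hmin
        have : (n₀ : ℤ) ≤ r.toNat := by exact_mod_cast hmin
        rw [Int.toNat_of_nonneg hr0] at this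
        omega
      have hcwj : c (cast w) j * D = (t : ℝ) * n₀ := by
        rw [ha, hdecomp, hr_zero]; push_cast; ring
      rw [hm]
      field_simp
      rw [hcwj]
    -- coordinates of finite combinations of the `V i`
    have c_zero : c 0 = 0 := by ext i; simp [c]
    have c_combo : ∀ (s : Finset (Fin q)) (t : Fin q → ℝ) (i' : Fin q),
        c (∑ i ∈ s, t i • V i) i' = ∑ i ∈ s, t i * (if i' = i then 1 else 0) := by
      intro s t i'
      induction s using Finset.induction_on with
      | empty => simp [c_zero]
      | insert a s ha ih =>
        rw [Finset.sum_insert ha, Finset.sum_insert ha, c_add, Pi.add_apply, ih, c_smul,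
          Pi.smul_apply, smul_eq_mul, c_V, Pi.single_apply]
    -- the nearest-plane reduction in `E`
    let u : Fin q → E := fun i => if i < j then Φ (V i) else 0
    let K : Submodule ℝ E := Submodule.span ℝ (Set.range u)
    have hu_lt : ∀ i, i < j → u i = Φ (V i) := fun i hi => if_pos hi
    have hu_ge : ∀ i, ¬ i < j → u i = 0 := fun i hi => if_neg hi
    have huK : ∀ i, u i ∈ K := fun i => Submodule.subset_span ⟨i, rfl⟩
    have hVK : ∀ i, i < j → Φ (V i) ∈ K := fun i hi => by rw [← hu_lt i hi]; exact huK i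
    let x : E := K.starProjection (Φ (cast w₀))
    have hxK : x ∈ K := Submodule.starProjection_apply_mem _ _
    obtain ⟨n, hn⟩ := exists_int_comb_norm_sub_sq_le q u x hxK
    -- the reduced vector
    let yj : Fin q → ℤ := w₀ - ∑ i ∈ Finset.univ.filter (fun i => i < j), n i • v i
    have hcast_sum : cast (∑ i ∈ Finset.univ.filter (fun i => i < j), n i • v i) =
        ∑ i ∈ Finset.univ.filter (fun i => i < j), (n i : ℝ) • V i := by
      ext k
      simp [cast, hV, Finset.sum_apply]
    have hcyj : ∀ i', c (cast yj) i' =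
        c (cast w₀) i' - if i' < j then (n i' : ℝ) else 0 := by
      intro i'
      simp only [yj]
      rw [cast_sub, c_sub, hcast_sum, Pi.sub_apply, c_combo, Finset.sum_mul_boole]
      simp
    -- `Φ yj = (x − ∑ nᵢ uᵢ) + (Φ w₀ − x)`, orthogonally
    have hΦcorr : Φ (cast (∑ i ∈ Finset.univ.filter (fun i => i < j), n i • v i)) =
        ∑ i, (n i : ℝ) • u i := by
      rw [hcast_sum, map_sum, Finset.sum_filter]
      refine Finset.sum_congr rfl fun i _ => ?_
      by_cases hi : i < j
      · rw [if_pos hi, map_smul, hu_lt i hi]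
      · rw [if_neg hi, hu_ge i hi, smul_zero]
    have hΦyj : Φ (cast yj) = (x - ∑ i, (n i : ℝ) • u i) + (Φ (cast w₀) - x) := by
      simp only [yj]
      rw [cast_sub, map_sub, hΦcorr]
      abel
    have haK : x - ∑ i, (n i : ℝ) • u i ∈ K :=
      K.sub_mem hxK (Submodule.sum_mem _ fun i _ => K.smul_mem _ (huK i))
    have hbK : Φ (cast w₀) - x ∈ Kᗮ := Submodule.sub_starProjection_mem_orthogonal _
    have hab := Submodule.inner_right_of_mem_orthogonal haK hbK
    have hpy := norm_add_sq_eq_norm_sq_add_norm_sq_real hab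
    -- `Φ w₀ − x = m (Φ v_j − P_K Φ v_j)`, of norm `≤ ‖Φ v_j‖`
    have hzK : Φ (cast w₀) - m • Φ (V j) ∈ K := by
      have hexp : Φ (cast w₀) - m • Φ (V j) =
          ∑ i, (c (cast w₀) i - if i = j then m else 0) • Φ (V i) := by
        have h1 : Φ (cast w₀) = ∑ i, c (cast w₀) i • Φ (V i) := by
          conv_lhs => rw [← c_sum (cast w₀)]
          rw [map_sum]
          exact Finset.sum_congr rfl fun i _ => by rw [map_smul]
        have h2 : ∑ i, (if i = j then m else 0) • Φ (V i) = m • Φ (V j) := by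
          rw [Finset.sum_eq_single j (fun i _ hi => by rw [if_neg hi, zero_smul])
            (fun h => absurd (Finset.mem_univ j) h), if_pos rfl]
        rw [h1, ← h2, ← Finset.sum_sub_distrib]
        exact Finset.sum_congr rfl fun i _ => by rw [sub_smul]
      rw [hexp]
      refine Submodule.sum_mem _ fun i _ => ?_
      rcases lt_trichotomy i j with hlt | heq | hgt
      · rw [if_neg hlt.ne, sub_zero]; exact K.smul_mem _ (hVK i hlt)
      · subst heq; rw [if_pos rfl, hcw₀, sub_self, zero_smul]; exact K.zero_mem
      · rw [if_neg hgt.ne', hw₀Λ i hgt, sub_zero, zero_smul]; exact K.zero_mem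
    have hb_eq : Φ (cast w₀) - x = m • (Φ (V j) - K.starProjection (Φ (V j))) := by
      have hPz : K.starProjection (Φ (cast w₀) - m • Φ (V j)) = Φ (cast w₀) - m • Φ (V j) :=
        Submodule.starProjection_eq_self_iff.mpr hzK
      have hsplit : Φ (cast w₀) = (Φ (cast w₀) - m • Φ (V j)) + m • Φ (V j) := by abel
      simp only [x]
      conv_lhs => rw [hsplit]
      rw [map_add, map_smul, hPz, smul_sub]
      abel
    have hb_le : ‖Φ (cast w₀) - x‖ ^ 2 ≤ ‖Φ (V j)‖ ^ 2 := by
      rw [hb_eq, norm_smul, Real.norm_eq_abs, abs_of_pos hm0]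
      have h1 : ‖Φ (V j) - K.starProjection (Φ (V j))‖ ≤ ‖Φ (V j)‖ :=
        norm_sub_starProjection_le_norm K _
      have h2 : m * ‖Φ (V j) - K.starProjection (Φ (V j))‖ ≤ 1 * ‖Φ (V j)‖ :=
        mul_le_mul hm1 h1 (norm_nonneg _) zero_le_one
      rw [one_mul] at h2
      exact pow_le_pow_left₀ (mul_nonneg hm0.le (norm_nonneg _)) h2 2
    -- `¼ ∑ ‖uᵢ‖² ≤ ¼ · j · ‖Φ v_j‖²`
    have hu_sum : ∑ i, ‖u i‖ ^ 2 ≤ (j : ℕ) * ‖Φ (V j)‖ ^ 2 := by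
      have h1 : ∀ i, ‖u i‖ ^ 2 ≤ if i < j then ‖Φ (V j)‖ ^ 2 else 0 := by
        intro i
        by_cases hi : i < j
        · rw [if_pos hi, hu_lt i hi]
          exact pow_le_pow_left₀ (norm_nonneg _) (hmono hi.le) 2
        · rw [if_neg hi, hu_ge i hi, norm_zero]; simp
      calc ∑ i, ‖u i‖ ^ 2 ≤ ∑ i : Fin q, (if i < j then ‖Φ (V j)‖ ^ 2 else 0) :=
            Finset.sum_le_sum fun i _ => h1 i
        _ = (j : ℕ) * ‖Φ (V j)‖ ^ 2 := by
            rw [Finset.sum_ite, Finset.sum_const_zero, add_zero, Finset.sum_const, nsmul_eq_mul]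
            congr 1
            have : (Finset.univ.filter fun i : Fin q => i < j) = Finset.Iio j := by
              ext i; simp
            rw [this, Fin.card_Iio]
    have hnorm : ‖Φ (cast yj)‖ ^ 2 ≤ ((j : ℕ) + 1) * ‖Φ (V j)‖ ^ 2 := by
      rw [hΦyj, sq, hpy]
      have ha := hn
      nlinarith [ha, hb_le, hu_sum, sq_nonneg ‖Φ (V j)‖]
    refine ⟨yj, m, hm0, hm1, ?_, ?_, hnorm, hdiv⟩
    · intro i hi
      rw [hcyj, hw₀Λ i hi, if_neg (not_lt.mpr hi.le)]; simp
    · rw [hcyj, if_neg (lt_irrefl j), hcw₀]; simp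
  choose y m hm0 hm1 hyΛ hyj hynorm hdiv using key
  refine ⟨y, ?_, ?_, fun j => hynorm j⟩
  · -- generation
    have gen : ∀ n : ℕ, n ≤ q → ∀ w : Fin q → ℤ, (∀ i : Fin q, n ≤ i.val → c (cast w) i = 0) →
        w ∈ Submodule.span ℤ (Set.range y) := by
      intro n
      induction n with
      | zero =>
        intro _ w hw
        have : w = 0 := cast_inj w 0 (by
          rw [show cast 0 = 0 from by ext i; simp [cast]]
          exact c_eq_zero _ fun i => hw i (Nat.zero_le _))
        rw [this]; exact Submodule.zero_mem _
      | succ n ih =>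
        intro hn w hw
        let jn : Fin q := ⟨n, by omega⟩
        have hwΛ : ∀ i, jn < i → c (cast w) i = 0 :=
          fun i hi => hw i (by exact Nat.succ_le_of_lt (Fin.lt_def.mp hi))
        obtain ⟨t, ht⟩ := hdiv jn w hwΛ
        set w' := w - t • y jn with hw'
        have hw'mem : w' ∈ Submodule.span ℤ (Set.range y) := by
          refine ih (by omega) w' fun i hi => ?_
          rw [hw', cast_sub, cast_zsmul, c_sub, c_smul, Pi.sub_apply, Pi.smul_apply, smul_eq_mul]
          rcases (show n ≤ i.val from hi).lt_or_eq with hlt | heq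
          · have hi' : jn < i := Fin.lt_def.mpr hlt
            rw [hwΛ i hi', hyΛ jn i hi']; ring
          · have : i = jn := Fin.ext heq.symm
            subst this
            rw [ht, hyj]; ring
        have : w = w' + t • y jn := by rw [hw']; abel
        rw [this]
        exact Submodule.add_mem _ hw'mem
          (Submodule.smul_mem _ _ (Submodule.subset_span ⟨jn, rfl⟩))
    refine Submodule.eq_top_iff'.mpr fun w => gen q le_rfl w fun i hi => absurd i.2 (by omega)
  · -- non-vanishing
    intro j hzero
    have h1 := hyj j
    have : c (cast (y j)) j = 0 := by
      rw [hzero, show cast 0 = 0 from by ext i; simp [cast]]; simp [c]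
    rw [this] at h1
    exact (hm0 j).ne' h1.symm

/-- **Product form**: with `y` as in `exists_int_basis_sq_le_of_directional`,
`(∏ ‖Φ y_j‖)² ≤ q! · (∏ ‖Φ v_j‖)²`, hence `∏ ‖Φ y_j‖ ≤ √(q!) · ∏ ‖Φ v_j‖`. [folklore] -/
theorem exists_int_basis_prod_le_sqrt_factorial (Φ : (Fin q → ℝ) →ₗ[ℝ] E)
    (v : Fin q → Fin q → ℤ) (hli : LinearIndependent ℝ (fun k i => (v k i : ℝ)))
    (hmono : Monotone (fun k => ‖Φ (fun i => (v k i : ℝ))‖)) :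
    ∃ y : Fin q → Fin q → ℤ, Submodule.span ℤ (Set.range y) = ⊤ ∧ (∀ j, y j ≠ 0) ∧
      ∏ j, ‖Φ (fun i => (y j i : ℝ))‖ ≤
        Real.sqrt (q.factorial : ℝ) * ∏ j, ‖Φ (fun i => (v j i : ℝ))‖ := by
  obtain ⟨y, hygen, hyne, hyle⟩ := exists_int_basis_sq_le_of_directional Φ v hli hmono
  refine ⟨y, hygen, hyne, ?_⟩
  have hsq : (∏ j, ‖Φ (fun i => (y j i : ℝ))‖) ^ 2 ≤
      (q.factorial : ℝ) * (∏ j, ‖Φ (fun i => (v j i : ℝ))‖) ^ 2 := by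
    rw [← Finset.prod_pow, ← Finset.prod_pow]
    calc ∏ j, ‖Φ (fun i => (y j i : ℝ))‖ ^ 2
        ≤ ∏ j : Fin q, (((j : ℕ) : ℝ) + 1) * ‖Φ (fun i => (v j i : ℝ))‖ ^ 2 :=
          Finset.prod_le_prod (fun j _ => sq_nonneg _) fun j _ => hyle j
      _ = (∏ j : Fin q, (((j : ℕ) : ℝ) + 1)) * ∏ j, ‖Φ (fun i => (v j i : ℝ))‖ ^ 2 :=
          Finset.prod_mul_distrib
      _ = (q.factorial : ℝ) * ∏ j, ‖Φ (fun i => (v j i : ℝ))‖ ^ 2 := by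
          congr 1
          rw [Fin.prod_univ_eq_prod_range (fun j => ((j : ℝ) + 1)) q]
          exact_mod_cast Finset.prod_range_add_one_eq_factorial q
  have hP : 0 ≤ ∏ j, ‖Φ (fun i => (v j i : ℝ))‖ := Finset.prod_nonneg fun j _ => norm_nonneg _
  have hY : 0 ≤ ∏ j, ‖Φ (fun i => (y j i : ℝ))‖ := Finset.prod_nonneg fun j _ => norm_nonneg _
  have h := Real.sqrt_le_sqrt hsq
  rw [Real.sqrt_sq hY, Real.sqrt_mul (Nat.cast_nonneg _), Real.sqrt_sq hP] at h
  exact h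

end Summit.ABC.StewartYu.PrincipalLattice

end
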